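import Literature.NumberTheory.Sieve.MontgomeryVaughan1975
import Literature.NumberTheory.Sieve.MontgomeryVaughan1975GaussSums
import Literature.NumberTheory.Sieve.SingularSeriesProofs
import HarnessLib

/-!
# Montgomery–Vaughan (1975), §§6 and 8: elementary tools — proved

H. L. Montgomery, R. C. Vaughan, *The exceptional set in Goldbach's problem*, Acta Arith. 27
(1975) 353–370 [MontgomeryVaughanActa1975]. Theorems only (no definitions, no named facts);
companion of `MontgomeryVaughan1975Zeros.lean`:

* `one_le_goldbachSingularSeries`, `twinPrimeConst_mul_div_totient_le` — `𝔖(n) ≥ 1` and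
  `𝔖(n) ≥ C₂ n/φ(n)` for even `n` (§8: the error terms of (6.17)/(7.1) carry the factor `n/φ(n)` of
  Lemma 5.5, the main term is `𝔖(n) n`).
* `min_half_div_two_le_one_sub_exp_neg`, `min_half_div_two_le_one_sub_rpow_neg` —
  `1 − y^{−η} ≥ ½ min(η log y, ½)` (the inequality behind (6.21) and (8.6): `n − ñ^{β̃}` is
  `≫ n (1 − β̃) log n`).
* `card_filter_dvd_Icc_le` — multiples of `d` in `[1, N]`.
* `integral_trigPoly_mul_trigPoly` — orthogonality on a unit interval for a product of two
  trigonometric polynomials (`∫ T² e(−nα) = J(n)`, `∫ T̃² e(−nα) = Ĩ(n)`, `∫ T T̃ e(−nα) = J̃(n)`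
  in §6; cf. `Literature.NumberTheory.Sieve.MontgomeryVaughan1975.integral_expSum_sq`).
-/

noncomputable section

open Finset MeasureTheory Filter
open scoped FourierTransform

namespace Literature.NumberTheory.Sieve.MontgomeryVaughan1975

/-! ### The singular series against `n/φ(n)` -/

/-- `𝔖(n) ≥ 1` for even `n`: `𝔖(n) = 2C₂ ∏_{p ∣ n, p>2} (p-1)/(p-2)` with `C₂ ≥ 1/2` and every factor
`≥ 1`. [folklore] -/
theorem one_le_goldbachSingularSeries {n : ℕ} (hn : Even n) : 1 ≤ goldbachSingularSeries n := by
  rw [goldbachSingularSeries, if_neg (Nat.not_odd_iff_even.mpr hn)]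
  have hC := half_le_twinPrimeConst
  have hP : (1 : ℝ) ≤ ∏ p ∈ n.primeFactors.filter (2 < ·), (((p : ℝ) - 1) / ((p : ℝ) - 2)) := by
    refine Finset.one_le_prod fun p hp => ?_
    have h3 : (3 : ℝ) ≤ p := by exact_mod_cast (Finset.mem_filter.mp hp).2
    rw [le_div_iff₀ (by linarith)]
    linarith
  nlinarith

/-- **`C₂ · n/φ(n) ≤ 𝔖(n)` for even `n ≠ 0`** (the comparison of the error terms of (6.17), which
carry the factor `n/φ(n)` of Lemma 5.5, with the main term `𝔖(n) n`, Montgomery–Vaughan 1975 §8):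
`n/φ(n) = 2 ∏_{p ∣ n, p > 2} p/(p-1)` and `p/(p-1) ≤ (p-1)/(p-2)`. [folklore] -/
theorem twinPrimeConst_mul_div_totient_le {n : ℕ} (hn : Even n) (h0 : n ≠ 0) :
    twinPrimeConst * ((n : ℝ) / (Nat.totient n : ℝ)) ≤ goldbachSingularSeries n := by
  rw [goldbachSingularSeries, if_neg (Nat.not_odd_iff_even.mpr hn), ← prod_primeFactors_div_eq h0]
  have h2 : 2 ∈ n.primeFactors := Nat.mem_primeFactors.mpr ⟨Nat.prime_two, even_iff_two_dvd.mp hn, h0⟩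
  have hfilt : n.primeFactors.filter (2 < ·) = n.primeFactors.erase 2 := by
    ext p
    simp only [Finset.mem_filter, Finset.mem_erase, Nat.mem_primeFactors]
    constructor
    · rintro ⟨hp, hlt⟩; exact ⟨by omega, hp⟩
    · rintro ⟨hne, hp⟩; exact ⟨hp, lt_of_le_of_ne hp.1.two_le (Ne.symm hne)⟩
  rw [hfilt, ← Finset.mul_prod_erase _ _ h2]
  have hC : 0 ≤ twinPrimeConst := le_trans (by norm_num) half_le_twinPrimeConst
  have hprod : ∏ p ∈ n.primeFactors.erase 2, ((p : ℝ) / ((p : ℝ) - 1)) ≤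
      ∏ p ∈ n.primeFactors.erase 2, (((p : ℝ) - 1) / ((p : ℝ) - 2)) := by
    refine Finset.prod_le_prod (fun p hp => ?_) (fun p hp => ?_)
    · have hp2 : (2 : ℝ) ≤ p := by
        exact_mod_cast (Nat.prime_of_mem_primeFactors (Finset.mem_of_mem_erase hp)).two_le
      exact div_nonneg (by linarith) (by linarith)
    · have hpp := Nat.prime_of_mem_primeFactors (Finset.mem_of_mem_erase hp)
      have hne : p ≠ 2 := Finset.ne_of_mem_erase hp
      have h3 : (3 : ℝ) ≤ p := by exact_mod_cast lt_of_le_of_ne hpp.two_le (Ne.symm hne)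
      rw [div_le_div_iff₀ (by linarith) (by linarith)]
      nlinarith
  have hP0 : 0 ≤ ∏ p ∈ n.primeFactors.erase 2, ((p : ℝ) / ((p : ℝ) - 1)) :=
    Finset.prod_nonneg fun p hp => by
      have hp2 : (2 : ℝ) ≤ p := by
        exact_mod_cast (Nat.prime_of_mem_primeFactors (Finset.mem_of_mem_erase hp)).two_le
      exact div_nonneg (by linarith) (by linarith)
  have h22 : ((2 : ℕ) : ℝ) / (((2 : ℕ) : ℝ) - 1) = 2 := by norm_num
  rw [h22]
  have := mul_le_mul_of_nonneg_left hprod hC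
  nlinarith

/-! ### Elementary inequalities -/

/-- `min(x, 1/2)/2 ≤ 1 − e^{−x}` for `x ≥ 0`. [folklore] -/
theorem min_half_div_two_le_one_sub_exp_neg {x : ℝ} (hx : 0 ≤ x) :
    min x (1 / 2) / 2 ≤ 1 - Real.exp (-x) := by
  rcases le_or_gt x (1 / 2) with h | h
  · rw [min_eq_left h]
    have hb := Real.abs_exp_sub_one_sub_id_le (x := -x) (by rw [abs_neg, abs_of_nonneg hx]; linarith)
    have h1 : Real.exp (-x) ≤ 1 - x + x ^ 2 := by
      have := (abs_le.mp hb).2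
      nlinarith
    nlinarith
  · rw [min_eq_right h.le]
    have h1 : Real.exp (-x) ≤ Real.exp (-(1 / 2)) := Real.exp_le_exp.mpr (by linarith)
    have h2 : Real.exp (-(1 / 2 : ℝ)) ≤ 3 / 4 := by
      have hb := Real.abs_exp_sub_one_sub_id_le (x := -(1 / 2 : ℝ)) (by norm_num)
      have := (abs_le.mp hb).2
      norm_num at this ⊢
      linarith
    linarith

/-- `min(η log y, 1/2)/2 ≤ 1 − y^{−η}` for `y ≥ 1`, `η ≥ 0` — the inequality behind
"`n − ñ^{β̃}` is `≫ n (1 − β̃) log n` when `(1 − β̃) log n ≪ 1`" (Montgomery–Vaughan 1975, (6.21),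
§8). [folklore] -/
theorem min_half_div_two_le_one_sub_rpow_neg {y η : ℝ} (hy : 1 ≤ y) (hη : 0 ≤ η) :
    min (η * Real.log y) (1 / 2) / 2 ≤ 1 - y ^ (-η) := by
  have h := min_half_div_two_le_one_sub_exp_neg (mul_nonneg hη (Real.log_nonneg hy))
  rwa [Real.rpow_def_of_pos (by linarith), show Real.log y * -η = -(η * Real.log y) by ring]

/-- The number of multiples of `d ≥ 1` in `[1, N]` is `⌊N/d⌋ ≤ N/d`. [folklore] -/
theorem card_filter_dvd_Icc_le (N : ℕ) {d : ℕ} (hd : 0 < d) :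
    (((Finset.Icc 1 N).filter fun n => d ∣ n).card : ℝ) ≤ (N : ℝ) / d := by
  rw [show Finset.Icc 1 N = Finset.Ioc 0 N from rfl, Nat.Ioc_filter_dvd_card_eq_div,
    le_div_iff₀ (by exact_mod_cast hd)]
  exact_mod_cast Nat.div_mul_le_self N d

/-! ### Orthogonality for products of trigonometric polynomials -/

/-- Orthogonality on a unit interval for a product of two trigonometric polynomials with
frequencies in `ℕ`: `∫_c^{c+1} (∑_{k∈A} u_k e(kα)) (∑_{k∈B} v_k e(kα)) e(−nα) dα = ∑∑_{k₁+k₂=n} u_{k₁} v_{k₂}`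
(the identities `∫ T(α)² e(−nα) dα = J(n)`, `∫ T̃(α)² e(−nα) dα = Ĩ(n)`, `∫ T T̃ e(−nα) = J̃(n)` behind
(6.17) of Montgomery–Vaughan 1975; cf. `integral_expSum_sq` for `S(α)²`). [folklore] -/
theorem integral_trigPoly_mul_trigPoly (A B : Finset ℕ) (u v : ℕ → ℂ) (c : ℝ) (n : ℕ) :
    ∫ α in c..c + 1, (∑ k ∈ A, u k * (𝐞 (k * α) : ℂ)) * (∑ k ∈ B, v k * (𝐞 (k * α) : ℂ)) *
        (𝐞 (-(n * α)) : ℂ) =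
      ∑ k₁ ∈ A, ∑ k₂ ∈ B, if k₁ + k₂ = n then u k₁ * v k₂ else 0 := by
  have hI : ∀ α : ℝ, (∑ k ∈ A, u k * (𝐞 (k * α) : ℂ)) * (∑ k ∈ B, v k * (𝐞 (k * α) : ℂ)) *
      (𝐞 (-(n * α)) : ℂ) =
      ∑ k₁ ∈ A, ∑ k₂ ∈ B, u k₁ * v k₂ * (𝐞 (((k₁ + k₂ - n : ℤ)) * α) : ℂ) := by
    intro α
    rw [Finset.sum_mul_sum, Finset.sum_mul]
    refine Finset.sum_congr rfl fun k₁ _ => ?_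
    rw [Finset.sum_mul]
    refine Finset.sum_congr rfl fun k₂ _ => ?_
    have harg : (((2 * Real.pi * ((k₁ + k₂ - n : ℤ) * α) : ℝ) : ℂ) * Complex.I) =
        ((2 * Real.pi * (k₁ * α) : ℝ) : ℂ) * Complex.I + ((2 * Real.pi * (k₂ * α) : ℝ) : ℂ) *
          Complex.I + ((2 * Real.pi * (-(n * α)) : ℝ) : ℂ) * Complex.I := by
      push_cast
      ring
    simp only [Real.fourierChar_apply]
    rw [harg, Complex.exp_add, Complex.exp_add]
    ring
  simp_rw [hI]
  have hcont : ∀ k₁ k₂ : ℕ, IntervalIntegrable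
      (fun α : ℝ => u k₁ * v k₂ * (𝐞 (((k₁ + k₂ - n : ℤ)) * α) : ℂ)) volume c (c + 1) := by
    intro k₁ k₂
    apply Continuous.intervalIntegrable
    fun_prop
  rw [intervalIntegral.integral_finsetSum fun k₁ _ =>
    Continuous.intervalIntegrable (by fun_prop) _ _]
  rw [Finset.sum_congr rfl fun k₁ _ => intervalIntegral.integral_finsetSum fun k₂ _ => hcont k₁ k₂]
  simp_rw [intervalIntegral.integral_const_mul, integral_fourierChar_intCast_unitInterval]
  refine Finset.sum_congr rfl fun k₁ _ => Finset.sum_congr rfl fun k₂ _ => ?_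
  have hiff : ((k₁ + k₂ - n : ℤ) = 0) ↔ k₁ + k₂ = n := by omega
  by_cases hkn : k₁ + k₂ = n
  · rw [if_pos (hiff.mpr hkn), if_pos hkn, mul_one]
  · rw [if_neg (mt hiff.mp hkn), if_neg hkn, mul_zero]

end Literature.NumberTheory.Sieve.MontgomeryVaughan1975
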